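import Literature.NumberTheory.Rogawski1990.DepthZeroKappaTransferTypeOneRowZeroTrace         -- ★ p851982 (C6)-4 (F0P3a-p08 lineage): ROW 0 readers `ncard_rankStratum_zero_eq_phi{One,Zero}_of_congr_traceTorusElt{Pi,}_of_count`
import Literature.NumberTheory.Rogawski1990.DepthZeroKappaTransferTypeOneUnitRowStrataTrace   -- ★ p851990 (C6)-5: UNIT ROW readers `sum_ncard_rankStrata_eq_phi{One,Zero}_of_congr_traceTorusElt{Pi,}_of_count`
import Literature.NumberTheory.Rogawski1990.DepthZeroKappaTransferTypeOneRowTwoTrace           -- ★ p852146 (C6)-2 (LH3-p02 (g6)): ROW 2 at the θ̄ = 1 trace literal `ncard_rankStratum_two_eq_of_congr_traceTorusEltPi`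
import Literature.NumberTheory.Rogawski1990.DepthZeroKappaTransferTypeOneRowTwoThetaZeroTrace  -- ★ p852060 (LH7-p03): ROW 2 at the θ̄ = 0 trace literal `ncard_rankStratum_two_eq_of_congr_traceTorusElt`
import HarnessLib

/-!
# The depth-zero κ-transfer, type (1): the THREE STRATA COUNTS at the TRACE literals `t_π^{(b)}`, `t_1^{(b)}` — every residue characteristic

Topic `NumberTheory/Rogawski1990`; namespace `Literature.NumberTheory.Rogawski1990`.  THEOREMS ONLY (no definition, no instance, no notation, no named
fact, no `sorry`); kernel lane `--supports stmt-HodgeConjecture-24833`; count-neutral.  Cell `pub/hodgecm-mathlib`, crux H413, (C6) LAYER-C re-type (dealer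
LH4-plan (g7) WORDS #55∕#58, (C6) READER CONTRACT): brick (C6)-6 STAGE 1 — the 2-free twin of ★ `DepthZeroKappaTransferTypeOneCounts` §3
(`rankStrata_counts_of_congr_flickerTorusElt{,One}`, which need `IsUnit (2 : 𝒪_w)` through the Cayley literal `t_π(x₁,x₂,x₃)` with `e = ½`).  Here the
literal is the TRACE-FRAME one of ★ `DepthZeroKappaTransferTypeOneSocketTrace` ∕ ★ `DepthZeroKappaTransferTypeOneGSideTrace` (p851882): an idempotent-trace
datum `b + σ b = 1` (`|b|_w ≤ 1`, `|σ b − b|_w = 1`, available in EVERY residue characteristic by ★ `WildSeamDockings`) replaces `½`, and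
`t_π^{(b)}(x₁,x₂,x₃) = !![x₁ σb + x₃ b, 0, π (x₁ − x₃); 0, x₂, 0; π′ b σb (x₁ − x₃), 0, x₁ b + x₃ σb]` (θ̄ = 1, `π` a uniformiser parameter that is not a norm),
`t_1^{(b)}` the same with `π = π′ = 1` (θ̄ = 0).

* §1 `rankStrata_counts_of_congr_traceTorusEltPi` — at a θ̄ = 1 trace literal the three Jordan-strata counts `n_k(t) = #{q : G′_v ⧸ K_v | q ∈ Fix t ∧ rank (red (q⁻¹ t q)_w − 1) = k}`
  of `Fix_t(G′_v ⧸ K_v)` are functions of the exponents `P, Q₁, Q₂` alone: `n₀ = φ₁(q; Q₁−1, P−1)` (★ (C6)-4 ROW 0), `n₂ = [Q₁+P odd ∧ Q₁+Q₂ even]·(q+1)² q^{Q₁+Q₂+P−2}`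
  (★ (C6)-2 ROW 2), `n₀ + n₁ + n₂ = φ₁(q; Q₁, P)` (★ (C6)-5 unit row).  Its CONCLUSION is, token for token, the hypothesis `hCPi` of ★ p851882
  `finsum_finExplicitDelta_mul_classOrbitalIntegral_depthZero_eq_of_split_trace`; its binders are the union of the three readers' outer binders plus the
  (C5)′ θ̄ = 1 inert EXPORT count `hX₁` at `(L, w)` (the readers' `_of_count` hypothesis, verbatim), discharged by the `…Closed` sequel once that export lands.
* §2 `rankStrata_counts_of_congr_traceTorusElt` — the θ̄ = 0 twin: `n₀ = φ₀(q; Q₁−1, Q₂−1, P−1)`, `n₂ = [Q₁+P even ∧ Q₁+Q₂ even]·(q+1)² q^{Q₁+Q₂+P−2}`,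
  `n₀ + n₁ + n₂ = φ₀(q; Q₁, Q₂, P)` under the ultrametric-isosceles side condition `htri`; CONCLUSION = the hypothesis `hCOne` of ★ p851882 token for token,
  modulo the θ̄ = 0 EXPORT count `hX₀`.

## References
* [Rogawski1990] J. D. Rogawski, *Automorphic Representations of Unitary Groups in Three Variables*, Ann. of Math. Stud. 123 (1990): §4.9 Prop. 4.9.1 (b) p. 55,
  Lemma 4.9.3 p. 56; §4.3 (4.3.1)–(4.3.2) p. 43.
* [Flicker1998UnitaryFL] Y. Z. Flicker, *Elementary proof of the fundamental lemma for a unitary group*, Canad. J. Math. 50 (1998): Prop. 3 p. 78, Props. 11–14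
  pp. 87–94, §6 Thm. 15 p. 95.
* [Kottwitz1986] R. Kottwitz, *Base change for unit elements of Hecke algebras*, Compositio Math. 60 (1986): §3.
-/

set_option autoImplicit false

open NumberField IsDedekindDomain Matrix
open Literature.NumberTheory.Automorphic Literature.NumberTheory.Automorphic.UnitaryGroup
open Literature.NumberTheory.Automorphic.IntegralReduction Literature.NumberTheory.GaloisRepresentations
open Literature.NumberTheory.Automorphic.HermitianLattice (unitaryInt)
open scoped Matrix MatrixGroups ValuativeRel

namespace Literature.NumberTheory.Rogawski1990

variable (L : Type) [Field L] [NumberField L] [IsCMField L] (H' : Matrix (Fin 3) (Fin 3) L)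
  {v : HeightOneSpectrum (𝓞 ↥(maximalRealSubfield L))}

set_option synthInstance.maxHeartbeats 200000 in  -- the coset action `U_w ↷ U_w ⧸ unitaryInt` (as in ★ (C6)-4∕(C6)-5)
set_option maxHeartbeats 400000 in
open scoped Classical in
/-- **THE THREE COUNTS AT A θ̄ = 1 TRACE LITERAL** (2-free twin of ★ `rankStrata_counts_of_congr_flickerTorusElt`): for `t ∈ G′_v` congruent by the isometry
`Tl` to `t_π^{(b)}(x₁,x₂,x₃)` (norm-one, pairwise distinct, `≡ 1 (mod 𝔪_w)` diagonal data with exponents `P, Q₁, Q₂`; `b + σ b = 1`, `|b|_w ≤ 1`,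
`|σ b − b|_w = 1`; `σ π = π`, `π π′ = 1`, `π ∉ N(L_v^×)`): `n₀(t) = φ₁(Q₁−1, P−1)` (★ (C6)-4), `n₂(t) = [Q₁+P odd ∧ Q₁+Q₂ even]·(q+1)² q^{Q₁+Q₂+P−2}`
(★ (C6)-2), `n₀(t) + n₁(t) + n₂(t) = φ₁(Q₁, P)` (★ (C6)-5) — modulo the (C5)′ θ̄ = 1 inert export count `hX₁` at `(L, w)`.  The conclusion is the text of
the hypothesis `hCPi` of ★ `finsum_finExplicitDelta_mul_classOrbitalIntegral_depthZero_eq_of_split_trace`, verbatim.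
[cite: Rogawski1990, §4.9 Prop. 4.9.1 (b) p. 55, Lemma 4.9.3 p. 56] [cite: Flicker1998UnitaryFL, Prop. 11 p. 87; §6 p. 95] [cite: Kottwitz1986, §3] -/
theorem rankStrata_counts_of_congr_traceTorusEltPi
    (hH' : (H'.map (IsCMField.complexConj L))ᵀ = H') (hH'u : IsUnit H') (w : PlacesOver L v)
    (hw : IsCMField.complexConj L • w.1 = w.1) (hv : Algebra.IsUnramifiedIn (𝓞 L) v.asIdeal)
    (hH'w : IsUnit (placeForm H' w.1)) (hH'i : hH'w.unit ∈ glInt 3 (w.1.adicCompletion L))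
    {b π π' : LocalRing L v} (hb : b + conjLocal L (IsCMField.complexConj L) v b = 1) (hbv : Valued.v (b w) ≤ 1)
    (hbδ : Valued.v ((conjLocal L (IsCMField.complexConj L) v b - b) w) = 1)
    (hσπ : conjLocal L (IsCMField.complexConj L) v π = π) (hππ : π * π' = 1)
    (hπN : ∀ z : LocalRing L v, conjLocal L (IsCMField.complexConj L) v z * z ≠ π)
    -- the (C5)′ θ̄ = 1 EXPORT count at `(L, w)`, carried as a hypothesis until it lands (text = ★ (C6)-4 ∕ (C6)-5 `_of_count` hypothesis, verbatim)
    (hX₁ : ∀ {b₀ : w.1.adicCompletion L}, b₀ + galAdicCompletionMap (L := L) (IsCMField.complexConj L) hw b₀ = 1 → Valued.v b₀ ≤ 1 →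
      Valued.v (galAdicCompletionMap (L := L) (IsCMField.complexConj L) hw b₀ - b₀) = 1 →
      ∀ {a₁ a₂ a₃ ϖ₁ ϖ₁' : w.1.adicCompletion L}, galAdicCompletionMap (L := L) (IsCMField.complexConj L) hw a₁ * a₁ = 1 →
      galAdicCompletionMap (L := L) (IsCMField.complexConj L) hw a₂ * a₂ = 1 → galAdicCompletionMap (L := L) (IsCMField.complexConj L) hw a₃ * a₃ = 1 →
      galAdicCompletionMap (L := L) (IsCMField.complexConj L) hw ϖ₁ = ϖ₁ → ϖ₁ * ϖ₁' = 1 →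
      (∀ z : w.1.adicCompletion L, galAdicCompletionMap (L := L) (IsCMField.complexConj L) hw z * z ≠ ϖ₁) →
      ∀ {t₀ : ↥(unitaryGroupOfForm (galAdicCompletionMap (L := L) (IsCMField.complexConj L) hw)
        (placeForm (Matrix.of fun i j : Fin 3 => if i.val + j.val + 1 = 3 then (1 : L) else 0) w.1))},
      ((t₀ : GL (Fin 3) (w.1.adicCompletion L)) : Matrix (Fin 3) (Fin 3) (w.1.adicCompletion L)) =
        !![a₁ * galAdicCompletionMap (L := L) (IsCMField.complexConj L) hw b₀ + a₃ * b₀, 0, ϖ₁ * (a₁ - a₃); 0, a₂, 0;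
          ϖ₁' * (b₀ * galAdicCompletionMap (L := L) (IsCMField.complexConj L) hw b₀ * (a₁ - a₃)), 0,
          a₁ * b₀ + a₃ * galAdicCompletionMap (L := L) (IsCMField.complexConj L) hw b₀] →
      ∀ {N N₁ N₂ : ℕ}, Valued.v (a₁ - a₃) = WithZero.exp (-(N : ℤ)) → Valued.v (a₁ - a₂) = WithZero.exp (-(N₁ : ℤ)) →
      Valued.v (a₃ - a₂) = WithZero.exp (-(N₂ : ℤ)) →
      {x : ↥(unitaryGroupOfForm (galAdicCompletionMap (L := L) (IsCMField.complexConj L) hw)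
          (placeForm (Matrix.of fun i j : Fin 3 => if i.val + j.val + 1 = 3 then (1 : L) else 0) w.1)) ⧸
        unitaryInt (galAdicCompletionMap (L := L) (IsCMField.complexConj L) hw)
          (placeForm (Matrix.of fun i j : Fin 3 => if i.val + j.val + 1 = 3 then (1 : L) else 0) w.1) | t₀ • x = x}.Finite →
      (Nat.card {x : ↥(unitaryGroupOfForm (galAdicCompletionMap (L := L) (IsCMField.complexConj L) hw)
          (placeForm (Matrix.of fun i j : Fin 3 => if i.val + j.val + 1 = 3 then (1 : L) else 0) w.1)) ⧸
        unitaryInt (galAdicCompletionMap (L := L) (IsCMField.complexConj L) hw)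
          (placeForm (Matrix.of fun i j : Fin 3 => if i.val + j.val + 1 = 3 then (1 : L) else 0) w.1) | t₀ • x = x} : ℚ) =
        Flicker1998.phiOne (Ideal.absNorm v.asIdeal) N₁ N) :
        ∀ {x₁ x₂ x₃ : LocalRing L v}, conjLocal L (IsCMField.complexConj L) v x₁ * x₁ = 1 → conjLocal L (IsCMField.complexConj L) v x₂ * x₂ = 1 → conjLocal L (IsCMField.complexConj L) v x₃ * x₃ = 1 →
      x₁ ≠ x₂ → x₂ ≠ x₃ → x₁ ≠ x₃ →
      ∀ (Tl : GL (Fin 3) (LocalRing L v)), formCongr (conjLocal L (IsCMField.complexConj L) v) Tl (Matrix.of fun i j : Fin 3 => if i.val + j.val + 1 = 3 then (1 : LocalRing L v) else 0) = (adelicForm L 3 H').map (adeleToLocal L v) →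
      ∀ (ψ : ↥(UnitaryGroup.«local» L (IsCMField.complexConj L) 3 H' v) ≃ₜ*
        ↥(UnitaryGroup.«local» L (IsCMField.complexConj L) 3 (Matrix.of fun i j : Fin 3 => if i.val + j.val + 1 = 3 then (1 : L) else 0) v))
      (t : (cmDatum L 3 H').Local v), (∀ g, (ψ g).val = Tl * g.val * Tl⁻¹) →
      (∀ g, g ∈ cmLocalIntegralLevel L 3 H' v ↔ ψ g ∈ cmLocalIntegralLevel L 3 (Matrix.of fun i j : Fin 3 => if i.val + j.val + 1 = 3 then (1 : L) else 0) v) →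
      (ψ t).val.val = !![x₁ * conjLocal L (IsCMField.complexConj L) v b + x₃ * b, 0, π * (x₁ - x₃); 0, x₂, 0; π' * (b * conjLocal L (IsCMField.complexConj L) v b * (x₁ - x₃)), 0, x₁ * b + x₃ * conjLocal L (IsCMField.complexConj L) v b] →
      ∀ {P Q₁ Q₂ : ℕ}, Valued.v (x₁ w - x₃ w) = WithZero.exp (-(P : ℤ)) → Valued.v (x₁ w - x₂ w) = WithZero.exp (-(Q₁ : ℤ)) →
      Valued.v (x₃ w - x₂ w) = WithZero.exp (-(Q₂ : ℤ)) →
      Valued.v (x₁ w - 1) < 1 → Valued.v (x₂ w - 1) < 1 → Valued.v (x₃ w - 1) < 1 →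
      (({q : (cmDatum L 3 H').Local v ⧸ cmLocalIntegralLevel L 3 H' v |
        q ∈ MulAction.fixedBy ((cmDatum L 3 H').Local v ⧸ cmLocalIntegralLevel L 3 H' v) t ∧
          (redMat ((((q.out⁻¹ * t * q.out : (cmDatum L 3 H').Local v)).val : GL (Fin 3) (LocalRing L v)).val.map
            (Pi.evalRingHom (fun w' : PlacesOver L v => w'.1.adicCompletion L) w)) - 1).rank = 0}.ncard : ℕ) : ℚ) =
        Flicker1998.phiOne (Ideal.absNorm v.asIdeal) (Q₁ - 1) (P - 1) ∧
      (({q : (cmDatum L 3 H').Local v ⧸ cmLocalIntegralLevel L 3 H' v |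
        q ∈ MulAction.fixedBy ((cmDatum L 3 H').Local v ⧸ cmLocalIntegralLevel L 3 H' v) t ∧
          (redMat ((((q.out⁻¹ * t * q.out : (cmDatum L 3 H').Local v)).val : GL (Fin 3) (LocalRing L v)).val.map
            (Pi.evalRingHom (fun w' : PlacesOver L v => w'.1.adicCompletion L) w)) - 1).rank = 2}.ncard : ℕ) : ℚ) =
        (if (Q₁ + P) % 2 = 1 ∧ (Q₁ + Q₂) % 2 = 0 then
          (((Ideal.absNorm v.asIdeal + 1) ^ 2 * Ideal.absNorm v.asIdeal ^ (Q₁ + Q₂ + P - 2) : ℕ) : ℚ) else 0) ∧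
      (({q : (cmDatum L 3 H').Local v ⧸ cmLocalIntegralLevel L 3 H' v |
        q ∈ MulAction.fixedBy ((cmDatum L 3 H').Local v ⧸ cmLocalIntegralLevel L 3 H' v) t ∧
          (redMat ((((q.out⁻¹ * t * q.out : (cmDatum L 3 H').Local v)).val : GL (Fin 3) (LocalRing L v)).val.map
            (Pi.evalRingHom (fun w' : PlacesOver L v => w'.1.adicCompletion L) w)) - 1).rank = 0}.ncard : ℕ) : ℚ) +
        (({q : (cmDatum L 3 H').Local v ⧸ cmLocalIntegralLevel L 3 H' v |
        q ∈ MulAction.fixedBy ((cmDatum L 3 H').Local v ⧸ cmLocalIntegralLevel L 3 H' v) t ∧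
          (redMat ((((q.out⁻¹ * t * q.out : (cmDatum L 3 H').Local v)).val : GL (Fin 3) (LocalRing L v)).val.map
            (Pi.evalRingHom (fun w' : PlacesOver L v => w'.1.adicCompletion L) w)) - 1).rank = 1}.ncard : ℕ) : ℚ) +
        (({q : (cmDatum L 3 H').Local v ⧸ cmLocalIntegralLevel L 3 H' v |
        q ∈ MulAction.fixedBy ((cmDatum L 3 H').Local v ⧸ cmLocalIntegralLevel L 3 H' v) t ∧
          (redMat ((((q.out⁻¹ * t * q.out : (cmDatum L 3 H').Local v)).val : GL (Fin 3) (LocalRing L v)).val.map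
            (Pi.evalRingHom (fun w' : PlacesOver L v => w'.1.adicCompletion L) w)) - 1).rank = 2}.ncard : ℕ) : ℚ) =
        Flicker1998.phiOne (Ideal.absNorm v.asIdeal) Q₁ P := by
  intro x₁ x₂ x₃ hx₁ hx₂ hx₃ h₁₂ h₂₃ h₁₃ Tl hTl ψ t hψ hlev hlit P Q₁ Q₂ hP hQ₁ hQ₂ hd₁ hd₂ hd₃
  refine ⟨ncard_rankStratum_zero_eq_phiOne_of_congr_traceTorusEltPi_of_count L H' hH' hH'u w hw hv hb hbv hbδ hσπ hππ hπN hx₁ hx₂ hx₃ h₁₂ h₂₃ h₁₃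
      Tl ψ t hψ hlev hlit hP hQ₁ hQ₂ hd₁ hd₂ hd₃ hX₁,
    ncard_rankStratum_two_eq_of_congr_traceTorusEltPi L H' hH' w hw hv hH'w hH'i hb hbv hσπ hππ hπN hx₁ hx₂ hx₃ Tl hTl ψ t hψ hlit hP hQ₁ hQ₂ hd₁ hd₂ hd₃, ?_⟩
  have hs := sum_ncard_rankStrata_eq_phiOne_of_congr_traceTorusEltPi_of_count L H' hH' hH'u w hw hb hbv hbδ hσπ hππ hπN hx₁ hx₂ hx₃ h₁₂ h₂₃ h₁₃
    Tl ψ t hψ hlev hlit hP hQ₁ hQ₂ hd₁ hd₂ hd₃ hX₁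
  simpa only [Finset.sum_range_succ, Finset.sum_range_zero, zero_add, Nat.cast_add] using hs
set_option synthInstance.maxHeartbeats 200000 in  -- the coset action `U_w ↷ U_w ⧸ unitaryInt` (as in ★ (C6)-4∕(C6)-5)
set_option maxHeartbeats 400000 in
open scoped Classical in
/-- **THE THREE COUNTS AT THE θ̄ = 0 TRACE LITERAL** (2-free twin of ★ `rankStrata_counts_of_congr_flickerTorusEltOne`): for `t ∈ G′_v` congruent by `Tl` to
`t_1^{(b)}(x₁,x₂,x₃)` (norm-one, pairwise distinct, `≡ 1 (mod 𝔪_w)`, exponents `P, Q₁, Q₂` in ultrametric-isosceles position `htri`; `b + σ b = 1`, `|b|_w ≤ 1`,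
`|σ b − b|_w = 1`): `n₀(t) = φ₀(Q₁−1, Q₂−1, P−1)` (★ (C6)-4), `n₂(t) = [Q₁+P even ∧ Q₁+Q₂ even]·(q+1)² q^{Q₁+Q₂+P−2}` (★ ROW 2 θ̄ = 0, p852060),
`n₀(t) + n₁(t) + n₂(t) = φ₀(Q₁, Q₂, P)` (★ (C6)-5) — modulo the (C5)′ θ̄ = 0 inert export count `hX₀` at `(L, w)`.  The conclusion is the text of the hypothesis
`hCOne` of ★ `finsum_finExplicitDelta_mul_classOrbitalIntegral_depthZero_eq_of_split_trace`, verbatim.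
[cite: Rogawski1990, §4.9 Prop. 4.9.1 (b) p. 55, Lemma 4.9.3 p. 56] [cite: Flicker1998UnitaryFL, Prop. 11 p. 87; §6 p. 95] [cite: Kottwitz1986, §3] -/
theorem rankStrata_counts_of_congr_traceTorusElt
    (hH' : (H'.map (IsCMField.complexConj L))ᵀ = H') (hH'u : IsUnit H') (w : PlacesOver L v)
    (hw : IsCMField.complexConj L • w.1 = w.1) (hv : Algebra.IsUnramifiedIn (𝓞 L) v.asIdeal)
    (hH'w : IsUnit (placeForm H' w.1)) (hH'i : hH'w.unit ∈ glInt 3 (w.1.adicCompletion L))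
    {b : LocalRing L v} (hb : b + conjLocal L (IsCMField.complexConj L) v b = 1) (hbv : Valued.v (b w) ≤ 1)
    (hbδ : Valued.v ((conjLocal L (IsCMField.complexConj L) v b - b) w) = 1)
    -- the (C5)′ θ̄ = 0 EXPORT count at `(L, w)`, carried as a hypothesis until it lands (text = ★ (C6)-4 ∕ (C6)-5 `_of_count` hypothesis, verbatim)
    (hX₀ : ∀ {b₀ : w.1.adicCompletion L}, b₀ + galAdicCompletionMap (L := L) (IsCMField.complexConj L) hw b₀ = 1 → Valued.v b₀ ≤ 1 →
      Valued.v (galAdicCompletionMap (L := L) (IsCMField.complexConj L) hw b₀ - b₀) = 1 →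
      ∀ {a₁ a₂ a₃ : w.1.adicCompletion L}, galAdicCompletionMap (L := L) (IsCMField.complexConj L) hw a₁ * a₁ = 1 →
      galAdicCompletionMap (L := L) (IsCMField.complexConj L) hw a₂ * a₂ = 1 → galAdicCompletionMap (L := L) (IsCMField.complexConj L) hw a₃ * a₃ = 1 →
      ∀ {t₀ : ↥(unitaryGroupOfForm (galAdicCompletionMap (L := L) (IsCMField.complexConj L) hw)
        (placeForm (Matrix.of fun i j : Fin 3 => if i.val + j.val + 1 = 3 then (1 : L) else 0) w.1))},
      ((t₀ : GL (Fin 3) (w.1.adicCompletion L)) : Matrix (Fin 3) (Fin 3) (w.1.adicCompletion L)) =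
        !![a₁ * galAdicCompletionMap (L := L) (IsCMField.complexConj L) hw b₀ + a₃ * b₀, 0, a₁ - a₃; 0, a₂, 0;
          b₀ * galAdicCompletionMap (L := L) (IsCMField.complexConj L) hw b₀ * (a₁ - a₃), 0,
          a₁ * b₀ + a₃ * galAdicCompletionMap (L := L) (IsCMField.complexConj L) hw b₀] →
      ∀ {N N₁ N₂ : ℕ}, Valued.v (a₁ - a₃) = WithZero.exp (-(N : ℤ)) → Valued.v (a₁ - a₂) = WithZero.exp (-(N₁ : ℤ)) →
      Valued.v (a₃ - a₂) = WithZero.exp (-(N₂ : ℤ)) →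
      ((N₁ = N₂ ∧ N₁ ≤ N) ∨ (N₁ = N ∧ N₁ ≤ N₂) ∨ (N₂ = N ∧ N₂ ≤ N₁)) →
      {x : ↥(unitaryGroupOfForm (galAdicCompletionMap (L := L) (IsCMField.complexConj L) hw)
          (placeForm (Matrix.of fun i j : Fin 3 => if i.val + j.val + 1 = 3 then (1 : L) else 0) w.1)) ⧸
        unitaryInt (galAdicCompletionMap (L := L) (IsCMField.complexConj L) hw)
          (placeForm (Matrix.of fun i j : Fin 3 => if i.val + j.val + 1 = 3 then (1 : L) else 0) w.1) | t₀ • x = x}.Finite →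
      (Nat.card {x : ↥(unitaryGroupOfForm (galAdicCompletionMap (L := L) (IsCMField.complexConj L) hw)
          (placeForm (Matrix.of fun i j : Fin 3 => if i.val + j.val + 1 = 3 then (1 : L) else 0) w.1)) ⧸
        unitaryInt (galAdicCompletionMap (L := L) (IsCMField.complexConj L) hw)
          (placeForm (Matrix.of fun i j : Fin 3 => if i.val + j.val + 1 = 3 then (1 : L) else 0) w.1) | t₀ • x = x} : ℚ) =
        Flicker1998.phiZero (Ideal.absNorm v.asIdeal) N₁ N₂ N) :
        ∀ {x₁ x₂ x₃ : LocalRing L v}, conjLocal L (IsCMField.complexConj L) v x₁ * x₁ = 1 → conjLocal L (IsCMField.complexConj L) v x₂ * x₂ = 1 → conjLocal L (IsCMField.complexConj L) v x₃ * x₃ = 1 →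
      x₁ ≠ x₂ → x₂ ≠ x₃ → x₁ ≠ x₃ →
      ∀ (Tl : GL (Fin 3) (LocalRing L v)), formCongr (conjLocal L (IsCMField.complexConj L) v) Tl (Matrix.of fun i j : Fin 3 => if i.val + j.val + 1 = 3 then (1 : LocalRing L v) else 0) = (adelicForm L 3 H').map (adeleToLocal L v) →
      ∀ (ψ : ↥(UnitaryGroup.«local» L (IsCMField.complexConj L) 3 H' v) ≃ₜ*
        ↥(UnitaryGroup.«local» L (IsCMField.complexConj L) 3 (Matrix.of fun i j : Fin 3 => if i.val + j.val + 1 = 3 then (1 : L) else 0) v))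
      (t : (cmDatum L 3 H').Local v), (∀ g, (ψ g).val = Tl * g.val * Tl⁻¹) →
      (∀ g, g ∈ cmLocalIntegralLevel L 3 H' v ↔ ψ g ∈ cmLocalIntegralLevel L 3 (Matrix.of fun i j : Fin 3 => if i.val + j.val + 1 = 3 then (1 : L) else 0) v) →
      (ψ t).val.val = !![x₁ * conjLocal L (IsCMField.complexConj L) v b + x₃ * b, 0, x₁ - x₃; 0, x₂, 0; b * conjLocal L (IsCMField.complexConj L) v b * (x₁ - x₃), 0, x₁ * b + x₃ * conjLocal L (IsCMField.complexConj L) v b] →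
      ∀ {P Q₁ Q₂ : ℕ}, Valued.v (x₁ w - x₃ w) = WithZero.exp (-(P : ℤ)) → Valued.v (x₁ w - x₂ w) = WithZero.exp (-(Q₁ : ℤ)) →
      Valued.v (x₃ w - x₂ w) = WithZero.exp (-(Q₂ : ℤ)) →
      ((Q₁ = Q₂ ∧ Q₁ ≤ P) ∨ (Q₁ = P ∧ Q₁ ≤ Q₂) ∨ (Q₂ = P ∧ Q₂ ≤ Q₁)) →
      Valued.v (x₁ w - 1) < 1 → Valued.v (x₂ w - 1) < 1 → Valued.v (x₃ w - 1) < 1 →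
      (({q : (cmDatum L 3 H').Local v ⧸ cmLocalIntegralLevel L 3 H' v |
        q ∈ MulAction.fixedBy ((cmDatum L 3 H').Local v ⧸ cmLocalIntegralLevel L 3 H' v) t ∧
          (redMat ((((q.out⁻¹ * t * q.out : (cmDatum L 3 H').Local v)).val : GL (Fin 3) (LocalRing L v)).val.map
            (Pi.evalRingHom (fun w' : PlacesOver L v => w'.1.adicCompletion L) w)) - 1).rank = 0}.ncard : ℕ) : ℚ) =
        Flicker1998.phiZero (Ideal.absNorm v.asIdeal) (Q₁ - 1) (Q₂ - 1) (P - 1) ∧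
      (({q : (cmDatum L 3 H').Local v ⧸ cmLocalIntegralLevel L 3 H' v |
        q ∈ MulAction.fixedBy ((cmDatum L 3 H').Local v ⧸ cmLocalIntegralLevel L 3 H' v) t ∧
          (redMat ((((q.out⁻¹ * t * q.out : (cmDatum L 3 H').Local v)).val : GL (Fin 3) (LocalRing L v)).val.map
            (Pi.evalRingHom (fun w' : PlacesOver L v => w'.1.adicCompletion L) w)) - 1).rank = 2}.ncard : ℕ) : ℚ) =
        (if (Q₁ + P) % 2 = 0 ∧ (Q₁ + Q₂) % 2 = 0 then
          (((Ideal.absNorm v.asIdeal + 1) ^ 2 * Ideal.absNorm v.asIdeal ^ (Q₁ + Q₂ + P - 2) : ℕ) : ℚ) else 0) ∧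
      (({q : (cmDatum L 3 H').Local v ⧸ cmLocalIntegralLevel L 3 H' v |
        q ∈ MulAction.fixedBy ((cmDatum L 3 H').Local v ⧸ cmLocalIntegralLevel L 3 H' v) t ∧
          (redMat ((((q.out⁻¹ * t * q.out : (cmDatum L 3 H').Local v)).val : GL (Fin 3) (LocalRing L v)).val.map
            (Pi.evalRingHom (fun w' : PlacesOver L v => w'.1.adicCompletion L) w)) - 1).rank = 0}.ncard : ℕ) : ℚ) +
        (({q : (cmDatum L 3 H').Local v ⧸ cmLocalIntegralLevel L 3 H' v |
        q ∈ MulAction.fixedBy ((cmDatum L 3 H').Local v ⧸ cmLocalIntegralLevel L 3 H' v) t ∧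
          (redMat ((((q.out⁻¹ * t * q.out : (cmDatum L 3 H').Local v)).val : GL (Fin 3) (LocalRing L v)).val.map
            (Pi.evalRingHom (fun w' : PlacesOver L v => w'.1.adicCompletion L) w)) - 1).rank = 1}.ncard : ℕ) : ℚ) +
        (({q : (cmDatum L 3 H').Local v ⧸ cmLocalIntegralLevel L 3 H' v |
        q ∈ MulAction.fixedBy ((cmDatum L 3 H').Local v ⧸ cmLocalIntegralLevel L 3 H' v) t ∧
          (redMat ((((q.out⁻¹ * t * q.out : (cmDatum L 3 H').Local v)).val : GL (Fin 3) (LocalRing L v)).val.map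
            (Pi.evalRingHom (fun w' : PlacesOver L v => w'.1.adicCompletion L) w)) - 1).rank = 2}.ncard : ℕ) : ℚ) =
        Flicker1998.phiZero (Ideal.absNorm v.asIdeal) Q₁ Q₂ P := by
  intro x₁ x₂ x₃ hx₁ hx₂ hx₃ h₁₂ h₂₃ h₁₃ Tl hTl ψ t hψ hlev hlit P Q₁ Q₂ hP hQ₁ hQ₂ htri hd₁ hd₂ hd₃
  refine ⟨ncard_rankStratum_zero_eq_phiZero_of_congr_traceTorusElt_of_count L H' hH' hH'u w hw hv hb hbv hbδ hx₁ hx₂ hx₃ h₁₂ h₂₃ h₁₃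
      Tl ψ t hψ hlev hlit hP hQ₁ hQ₂ htri hd₁ hd₂ hd₃ hX₀,
    ncard_rankStratum_two_eq_of_congr_traceTorusElt L H' hH' w hw hv hH'w hH'i hb hx₁ hx₂ hx₃ Tl hTl ψ t hψ hlit hP hQ₁ hQ₂ hd₁ hd₂ hd₃, ?_⟩
  have hs := sum_ncard_rankStrata_eq_phiZero_of_congr_traceTorusElt_of_count L H' hH' hH'u w hw hb hbv hbδ hx₁ hx₂ hx₃ h₁₂ h₂₃ h₁₃
    Tl ψ t hψ hlev hlit hP hQ₁ hQ₂ htri hd₁ hd₂ hd₃ hX₀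
  simpa only [Finset.sum_range_succ, Finset.sum_range_zero, zero_add, Nat.cast_add] using hs

end Literature.NumberTheory.Rogawski1990
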